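import Literature.NumberTheory.Automorphic.AutomorphicRepsGLCuspFormsRapidDecayMW
import Literature.NumberTheory.Automorphic.AutomorphicRepsGLCuspFormsRapidDecayMWScaling
import Literature.NumberTheory.Automorphic.CuspFormsRapidDecayLevel
import Literature.NumberTheory.Automorphic.CuspConditionGLLieDeriv
import Literature.NumberTheory.Automorphic.PeriodicDerivativeChain
import HarnessLib

/-!
# Proof of Moeglin–Waldspurger's Lemma I.2.10 for `GL_n` over a number field, cuspidal case
(discharge of the named fact `AutomorphicRepsGL.siegelGrowthBound_rootShift_of_cuspCondition` of
`AutomorphicRepsGLCuspFormsRapidDecayMW`; Moeglin–Waldspurger, *Spectral decomposition and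
Eisenstein series* (1995), Lemma I.2.10 and its proof, pp. 35–37)

Topic `NumberTheory/Automorphic`. Let `φ : GL_n(𝔸_K) → ℂ` be left `GL_n(K)`-invariant, smooth in
the archimedean variable, right invariant under an admissible level `U`, with vanishing constant
term along the maximal parabolic `P_{j₀}` (`CuspConditionGL n K φ j₀`, simple root
`α = e_{i₀} - e_{j₀}`, `j₀ = i₀ + 1`), and suppose all derivatives `p φ` satisfy the Siegel growth
bound with exponents `(r, Λ)` (`SiegelGrowthBoundGL hcpt φ r Λ`). We PROVE that they satisfy it
with exponents `(r, Λ - t α)` for every `t > 0`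
(`AutomorphicRepsGL.siegelGrowthBound_rootShift_of_cuspCondition_holds`), following the printed
proof with the simplifications available for `GL_n` (the unipotent radical `N = 1 + 𝔫_{j₀}` is
abelian, so no filtration is needed, and for a *cuspidal* `φ` the telescoping sum
`φ - φ_P = ∑ (φ_{i-1} - φ_i)` collapses to a single mean-zero statement) and with Fourier inversion
on `(ℤ\ℝ)^d` replaced by the elementary oscillation bound for periodic functions through chains of
derivatives (`PeriodicDerivativeChain`):

1. (level, MW's `Γ_i`) for the Siegel datum `(Ω, t₁)` choose `0 ≠ c ∈ 𝓞 K` such that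
   `y⁻¹ (1 + P) y ∈ U` for every Siegel-set point `y = z(ρ) ω diag(a) k` (and its left translates by
   archimedean unipotents) and every `P ∈ 𝔫(𝔸_K)` with `P_∞ = 0` and `c`-divisible integral finite
   entries (`CuspFormsRapidDecayLevel`); then `ψ((1 + X) y)`, for `X` in the scaled Tate domain
   `c · 𝓕₀`, only depends on the archimedean part `X_∞` (`finite steps drop out`), and
   `G(e) = ψ((1 + e) y)` (`e ∈ 𝔫(K_∞)`, `archUnipotent`) is periodic under the lattice
   `(c 𝓞_K)^{𝔫}` (left invariance under `N(K)` plus the level; `apply_archUnipotent_add_period_mul`);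
2. (mean zero) by the cusp condition `‖ψ(y)‖` is at most the oscillation of `G`
   (`norm_le_of_cuspConditionGL`);
3. (integration by parts ⇝ derivative chains) the oscillation of `G` is at most
   `∑_ι sup_e ‖(X'_ι^h ψ)((1+e) y)‖` over a `ℤ`-basis `B_ι` of the period lattice, where
   `X'_ι = Ad(y_∞⁻¹) B_ι` (`twistedBlockDir`, `hasDerivAt_blockDerivChain`,
   `norm_sub_le_sum_of_derivChains_of_basis`), `h = ⌈t⌉ ⊔ 1`;
4. (MW's assertion (1)) the coordinates of `X'_ι` in a basis of `𝔤𝔩_n(K_∞)` are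
   `O((a_{j₀}/a_{i₀}))` on the Siegel set (`exists_forall_abs_coord_twistedBlockDir_le`), so by
   multilinearity `‖(X'_ι^h ψ)(g)‖ ≤ D^h C^h (a_{i₀}/a_{j₀})^{-h} max_J ‖(b_J ψ)(g)‖` over the basis
   words `b_J` of length `h` (`norm_iterLieDeriv_ofFn_apply_le`);
5. (the hypothesis at translated points) by periodicity `e` may be taken in the compact closure of
   the fundamental parallelepiped, and then `(1 + e) y = z(ρ) ((1+e) ω) diag(a) k` lies in the Siegel
   set of the datum `((1 + P̄) Ω, t₁)`, where the hypothesis bounds `‖(b_J ψ)‖` by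
   `C_J (ρ ⊔ ρ⁻¹)^r ∏ aᵢ^{Λᵢ}`;
6. finally `(a_{i₀}/a_{j₀})^{-h} ≤ t₁^{-(h-t)} (a_{i₀}/a_{j₀})^{-t}` on the cone ("`m_{P₀}(g)^α` is
   bounded below on `S`"), and the conclusion for a general `p φ` follows by applying 1–6 to the
   cuspidal functions `X₁ ⋯ X_m φ` (`CuspConditionGL.iterLieDeriv`, "replace `φ` by `δ(X)φ`").

Everything here is proved; no new definition except the auxiliary `ratBlock` (rational block
matrices from block coordinates) and the period bases `periodBasis`, `blockPeriodBasis`.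

## References

* C. Moeglin, J.-L. Waldspurger, *Spectral decomposition and Eisenstein series*, Cambridge Tracts
  in Math. 113 (1995), I.2.1, Lemma I.2.10 and its proof [MoeglinWaldspurger1995].
* Harish-Chandra, *Automorphic forms on semisimple Lie groups*, LNM 62 (1968), Lemma 10 (MW's
  [HC]).
-/

noncomputable section

open scoped NNReal MatrixGroups Pointwise Matrix Classical
open NumberField NumberField.mixedEmbedding IsDedekindDomain Set
open _root_.Topology

namespace Literature.NumberTheory.Automorphic

/-! ### 1. Finite components of the Siegel factors; the uniform level -/

section Level

variable {n : ℕ} {K : Type} [Field K] [NumberField K]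

/-- Entries of the finite component `g_f = GLn.sndHom g` (definitional). [folklore] -/
theorem GLn.coe_sndHom_apply (g : GL (Fin n) (AdeleRing (𝓞 K) K)) (i j : Fin n) :
    ((GLn.sndHom n K g : GL (Fin n) (FiniteAdeleRing (𝓞 K) K)) :
        Matrix (Fin n) (Fin n) (FiniteAdeleRing (𝓞 K) K)) i j =
      ((g : Matrix (Fin n) (Fin n) (AdeleRing (𝓞 K) K)) i j).2 :=
  rfl

/-- **`z(ρ) ∈ A_G` has trivial finite component.** [folklore] -/
theorem GLn.sndHom_posRealScalar (ρ : ℝ≥0ˣ) : GLn.sndHom n K (posRealScalar n K ρ) = 1 := by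
  refine Matrix.GeneralLinearGroup.ext fun i j => ?_
  rw [GLn.coe_sndHom_apply]
  change ((Matrix.scalar (Fin n) ((posRealIdele K ρ : (AdeleRing (𝓞 K) K)ˣ) : AdeleRing (𝓞 K) K) i j).2) =
    (1 : Matrix (Fin n) (Fin n) (FiniteAdeleRing (𝓞 K) K)) i j
  rw [Matrix.scalar_apply, Matrix.diagonal_apply, Matrix.one_apply]
  split_ifs with h
  · exact posRealIdele_snd K ρ
  · rfl

/-- **`diag(a) ∈ A_{T₀}` has trivial finite component.** [folklore] -/
theorem GLn.sndHom_posRealDiagonal (a : Fin n → ℝ≥0ˣ) :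
    GLn.sndHom n K (posRealDiagonal n K a) = 1 := by
  refine Matrix.GeneralLinearGroup.ext fun i j => ?_
  rw [GLn.coe_sndHom_apply, coe_posRealDiagonal, Matrix.diagonal_apply, Units.val_one, Matrix.one_apply]
  split_ifs with h
  · exact posRealIdele_snd K (a i)
  · rfl

/-- Archimedean block unipotents have trivial finite component. [folklore] -/
theorem GLn.sndHom_archUnipotent {k : ℕ} (e : ArchBlockSpace n k K) :
    GLn.sndHom n K (archUnipotent n k K e) = 1 := by
  rw [archUnipotent_eq_ofInfinite, GLn.sndHom_ofInfinite]

/-- **The finite component of a Siegel-set point** `y = z(ρ) ω diag(a) k` is that of `ω k`.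
[folklore] -/
theorem GLn.sndHom_siegelPoint (ρ : ℝ≥0ˣ) (ω : GL (Fin n) (AdeleRing (𝓞 K) K)) (a : Fin n → ℝ≥0ˣ)
    (k : GL (Fin n) (AdeleRing (𝓞 K) K)) :
    GLn.sndHom n K (posRealScalar n K ρ * (ω * posRealDiagonal n K a * k)) = GLn.sndHom n K (ω * k) := by
  rw [map_mul, map_mul, map_mul, map_mul, GLn.sndHom_posRealScalar, GLn.sndHom_posRealDiagonal,
    one_mul, mul_one]

/-- A block unipotent with `c`-divisible integral finite part has trivial archimedean component.
[folklore] -/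
theorem GLn.fstHom_unipotentOfBlock_of_mem_finIntegralBlock {k : ℕ} {c : 𝓞 K}
    {P : blockNilpotent n k (AdeleRing (𝓞 K) K)} (hP : P ∈ finIntegralBlock c) :
    GLn.fstHom n K (unipotentOfBlock n k (AdeleRing (𝓞 K) K) (Multiplicative.ofAdd P)) = 1 := by
  refine Matrix.GeneralLinearGroup.ext fun i j => ?_
  change (((1 : Matrix (Fin n) (Fin n) (AdeleRing (𝓞 K) K)) +
    (P : Matrix (Fin n) (Fin n) (AdeleRing (𝓞 K) K))) i j).1 =
      (1 : Matrix (Fin n) (Fin n) (InfiniteAdeleRing K)) i j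
  rw [Matrix.add_apply]
  change ((1 : Matrix (Fin n) (Fin n) (AdeleRing (𝓞 K) K)) i j).1 +
    ((P : Matrix (Fin n) (Fin n) (AdeleRing (𝓞 K) K)) i j).1 = _
  rw [hP.1 i j, add_zero, fst_one_apply]

/-- **The uniform level** (Moeglin–Waldspurger (1995), proof of Lemma I.2.10, the compact open
subgroup `Γ_i = V_i(𝔸_f) ∩ ⋂_{g ∈ S} g K'_f g⁻¹`): for an admissible level `U` and a compact
`Θ ⊆ GL_n(𝔸_K)` there is `0 ≠ c ∈ 𝓞 K` such that `y⁻¹ (1 + P) y ∈ U` for every block-nilpotent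
`P` with `P_∞ = 0` and `c`-divisible integral finite entries (`finIntegralBlock c`, any block) and
every `y` whose *finite component* is that of an element of `Θ` (the conjugate only depends on
`y_f`; `exists_forall_conj_mem_of_mem_finiteLevelsGL` of `CuspFormsRapidDecayLevel`).
[cite: MoeglinWaldspurger1995, proof of Lemma I.2.10] -/
theorem exists_int_forall_conj_unipotentOfBlock_mem {U : Subgroup (GL (Fin n) (AdeleRing (𝓞 K) K))}
    (hU : U ∈ finiteLevelsGL n K) {Θ : Set (GL (Fin n) (AdeleRing (𝓞 K) K))} (hΘ : IsCompact Θ) :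
    ∃ c : 𝓞 K, c ≠ 0 ∧ ∀ (k : ℕ) (P : blockNilpotent n k (AdeleRing (𝓞 K) K)),
      P ∈ finIntegralBlock c → ∀ y : GL (Fin n) (AdeleRing (𝓞 K) K),
        (∃ θ ∈ Θ, GLn.sndHom n K y = GLn.sndHom n K θ) →
          y⁻¹ * unipotentOfBlock n k (AdeleRing (𝓞 K) K) (Multiplicative.ofAdd P) * y ∈ U := by
  obtain ⟨𝔫, h𝔫, hconj⟩ := exists_forall_conj_mem_of_mem_finiteLevelsGL hU hΘ
  have hbot : (𝔫 : Submodule (𝓞 K) (𝓞 K)) ≠ ⊥ := by rwa [Ne, ← Submodule.zero_eq_bot]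
  obtain ⟨c, hc𝔫, hc0⟩ := 𝔫.ne_bot_iff.1 hbot
  refine ⟨c, hc0, fun k P hP y ⟨θ, hθ, hyθ⟩ => ?_⟩
  have hκ := unipotentOfBlock_mem_principalCongruenceLevel_of_mem_finIntegralBlock (n := n) h𝔫 hc𝔫 hP
  have h1 := GLn.fstHom_unipotentOfBlock_of_mem_finIntegralBlock hP
  rw [GLn.inv_mul_mul_eq_ofFinite h1 y, hyθ, ← GLn.inv_mul_mul_eq_ofFinite h1 θ]
  exact hconj θ hθ _ hκ

end Level

/-! ### 2. Rational block matrices and the period lattice -/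

section Period

variable {n k : ℕ} {K : Type} [Field K] [NumberField K]

variable (n k K) in
/-- **The rational block matrix with block coordinates `w`**: the block-nilpotent adelic matrix
whose entry at the block position `κ` is the principal adele of `w κ ∈ K` (MW's
`exp(∑ x_ℓ X_{iℓ})` at integer points `x ∈ ℤ^d`, i.e. the elements of `V_i(k)`). [folklore] -/
def ratBlock (w : BlockPos n k → K) : blockNilpotent n k (AdeleRing (𝓞 K) K) :=
  ⟨Matrix.of fun i j => if h : (i : ℕ) < k ∧ k ≤ (j : ℕ) then
      algebraMap K (AdeleRing (𝓞 K) K) (w ⟨(i, j), h⟩) else 0,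
    fun i j hij => by
      by_contra h
      exact hij (by rw [Matrix.of_apply, dif_neg h])⟩

/-- Entries of `ratBlock w`. [folklore] -/
theorem coe_ratBlock_apply (w : BlockPos n k → K) (i j : Fin n) :
    ((ratBlock n k K w : blockNilpotent n k (AdeleRing (𝓞 K) K)) :
        Matrix (Fin n) (Fin n) (AdeleRing (𝓞 K) K)) i j =
      if h : (i : ℕ) < k ∧ k ≤ (j : ℕ) then algebraMap K (AdeleRing (𝓞 K) K) (w ⟨(i, j), h⟩) else 0 :=
  rfl

/-- `ratBlock w` is a rational block matrix (`𝔫_k(K)`). [folklore] -/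
theorem ratBlock_mem_rationalBlock (w : BlockPos n k → K) : ratBlock n k K w ∈ rationalBlock n k K := by
  intro i j
  rw [coe_ratBlock_apply]
  split_ifs with h
  · exact ⟨_, rfl⟩
  · exact ⟨0, map_zero _⟩

/-- **The archimedean part of `ratBlock w` is the archimedean block of the mixed embeddings of the
coordinates** (`mixedEmbedding K x = ringEquiv_mixedSpace (x)_∞`, Mathlib
`mixedEmbedding_eq_algebraMap_comp`). [folklore] -/
theorem blockArchPart_ratBlock (w : BlockPos n k → K) :
    blockArchPart (ratBlock n k K w) = archBlock n k K fun κ => mixedEmbedding K (w κ) := by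
  refine Subtype.ext (Matrix.ext fun i j => Prod.ext ?_ ?_)
  · rw [fst_blockArchPart_apply, fst_archBlock_apply, coe_ratBlock_apply]
    by_cases h : (i : ℕ) < k ∧ k ≤ (j : ℕ)
    · rw [dif_pos h, blockMatrixOf_apply_of_mem _ h, AdeleRing.algebraMap_fst,
        InfiniteAdeleRing.mixedEmbedding_eq_algebraMap_comp, RingEquiv.symm_apply_apply]
    · rw [dif_neg h, blockMatrixOf_apply_of_not _ h, map_zero]
      rfl
  · rw [snd_archBlock_apply]
    rfl

/-- **The finite part of `ratBlock (c w)`, `w` integral, is a finite `c`-divisible integral step.**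
[folklore] -/
theorem blockFinPart_ratBlock_mem_finIntegralBlock (c : 𝓞 K) (w : BlockPos n k → 𝓞 K) :
    blockFinPart (ratBlock n k K fun κ => ((c * w κ : 𝓞 K) : K)) ∈ finIntegralBlock c := by
  refine ⟨fun i j => fst_blockFinPart_apply _ i j, fun i j => ?_⟩
  rw [snd_blockFinPart_apply, coe_ratBlock_apply]
  by_cases h : (i : ℕ) < k ∧ k ≤ (j : ℕ)
  · refine ⟨algebraMap (𝓞 K) (FiniteAdeleRing (𝓞 K) K) (w ⟨(i, j), h⟩),
      fun v => HeightOneSpectrum.coe_algebraMap_mem (𝓞 K) K v _, ?_⟩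
    rw [dif_pos h, AdeleRing.algebraMap_snd, RingOfIntegers.coe_eq_algebraMap, map_mul, map_mul,
      ← IsScalarTower.algebraMap_apply, ← IsScalarTower.algebraMap_apply]
  · refine ⟨0, zero_mem _, ?_⟩
    rw [dif_neg h, mul_zero]
    rfl

/-- **Periodicity under rational-integral block translations.** Let `f` be left
`GL_n(K)`-invariant and right invariant under `U`, and let `y` be such that `y⁻¹ (1 + P) y ∈ U`
for all finite `c`-divisible integral steps `P`. Then for integral block coordinates `w`,
`f ((1 + (e + (c w)_∞)) y) = f ((1 + e) y)`: `1 + (c w)_∞ = (1 + c w) · (1 - (c w)_f)` with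
`1 + c w ∈ N(K) ≤ GL_n(K)` (left invariance) and `1 - (c w)_f` a finite step absorbed by the level
after commuting it past the archimedean unipotent `1 + e` (`N` is abelian). This is MW's
"the function `(x_ℓ) ↦ φ_{i-1}(exp(∑ x_ℓ X_{iℓ}) a g)` is invariant under `ℤ^d`".
[cite: MoeglinWaldspurger1995, proof of Lemma I.2.10] -/
theorem apply_archUnipotent_add_rat_mul {f : GL (Fin n) (AdeleRing (𝓞 K) K) → ℂ}
    (hleft : IsLeftInvariant (AdelicGroupData.gl n K) f)
    {U : Subgroup (GL (Fin n) (AdeleRing (𝓞 K) K))} (hfU : IsRightInvariantUnder U f) {c : 𝓞 K}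
    {y : GL (Fin n) (AdeleRing (𝓞 K) K)}
    (hy : ∀ P : blockNilpotent n k (AdeleRing (𝓞 K) K), P ∈ finIntegralBlock c →
      y⁻¹ * unipotentOfBlock n k (AdeleRing (𝓞 K) K) (Multiplicative.ofAdd P) * y ∈ U)
    (w : BlockPos n k → 𝓞 K) (e : ArchBlockSpace n k K) :
    f (archUnipotent n k K (e + fun κ => mixedEmbedding K ((c * w κ : 𝓞 K) : K)) * y) =
      f (archUnipotent n k K e * y) := by
  set γ : blockNilpotent n k (AdeleRing (𝓞 K) K) := ratBlock n k K fun κ => ((c * w κ : 𝓞 K) : K)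
    with hγ
  have hγrat : γ ∈ rationalBlock n k K := ratBlock_mem_rationalBlock _
  have harch : archBlock n k K (fun κ => mixedEmbedding K ((c * w κ : 𝓞 K) : K)) =
      γ + (-blockFinPart γ) := by
    rw [← blockArchPart_ratBlock, ← sub_eq_add_neg, eq_sub_iff_add_eq]
    exact blockArchPart_add_blockFinPart γ
  have hfin : -blockFinPart γ ∈ finIntegralBlock c :=
    neg_mem (blockFinPart_ratBlock_mem_finIntegralBlock c w)
  have hsplit : archUnipotent n k K (fun κ => mixedEmbedding K ((c * w κ : 𝓞 K) : K)) =
      unipotentOfBlock n k (AdeleRing (𝓞 K) K) (Multiplicative.ofAdd γ) *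
        unipotentOfBlock n k (AdeleRing (𝓞 K) K) (Multiplicative.ofAdd (-blockFinPart γ)) := by
    change unipotentOfBlock n k (AdeleRing (𝓞 K) K) (Multiplicative.ofAdd (archBlock n k K _)) = _
    rw [harch, ofAdd_add, map_mul]
  rw [add_comm, archUnipotent_add, hsplit]
  have h2 : unipotentOfBlock n k (AdeleRing (𝓞 K) K) (Multiplicative.ofAdd γ) *
      unipotentOfBlock n k (AdeleRing (𝓞 K) K) (Multiplicative.ofAdd (-blockFinPart γ)) *
        archUnipotent n k K e * y =
      unipotentOfBlock n k (AdeleRing (𝓞 K) K) (Multiplicative.ofAdd γ) *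
        (unipotentOfBlock n k (AdeleRing (𝓞 K) K) (Multiplicative.ofAdd (-blockFinPart γ)) *
          archUnipotent n k K e * y) := by
    simp only [mul_assoc]
  have h1 : f (unipotentOfBlock n k (AdeleRing (𝓞 K) K) (Multiplicative.ofAdd γ) *
      (unipotentOfBlock n k (AdeleRing (𝓞 K) K) (Multiplicative.ofAdd (-blockFinPart γ)) *
        archUnipotent n k K e * y)) =
      f (unipotentOfBlock n k (AdeleRing (𝓞 K) K) (Multiplicative.ofAdd (-blockFinPart γ)) *
        archUnipotent n k K e * y) :=
    hleft _ (glUnipotent_mem_arithmeticSubgroup hγrat) _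
  have hcomm : unipotentOfBlock n k (AdeleRing (𝓞 K) K) (Multiplicative.ofAdd (-blockFinPart γ)) *
      archUnipotent n k K e =
      archUnipotent n k K e *
        unipotentOfBlock n k (AdeleRing (𝓞 K) K) (Multiplicative.ofAdd (-blockFinPart γ)) :=
    ((Commute.all (Multiplicative.ofAdd (-blockFinPart γ)) (Multiplicative.ofAdd (archBlock n k K e))).map
      (unipotentOfBlock n k (AdeleRing (𝓞 K) K))).eq
  rw [h2, h1, hcomm]
  exact apply_unipotentOfBlock_mul_eq_of_conj_mem hfU (hy _ hfin) _

variable (K) in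
/-- Multiplication by the mixed embedding of `c ≠ 0`, a real-linear automorphism of the mixed
space (inverse: multiplication by the embedding of `c⁻¹`). [folklore] -/
def mulMixedEmbeddingEquiv (c : K) (hc : c ≠ 0) : mixedSpace K ≃ₗ[ℝ] mixedSpace K :=
  LinearEquiv.ofLinear (LinearMap.mulLeft ℝ (mixedEmbedding K c)) (LinearMap.mulLeft ℝ (mixedEmbedding K c⁻¹))
    (by
      refine LinearMap.ext fun x => ?_
      simp only [LinearMap.coe_comp, Function.comp_apply, LinearMap.mulLeft_apply, LinearMap.id_coe,
        id_eq, ← mul_assoc, ← map_mul, mul_inv_cancel₀ hc, map_one, one_mul])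
    (by
      refine LinearMap.ext fun x => ?_
      simp only [LinearMap.coe_comp, Function.comp_apply, LinearMap.mulLeft_apply, LinearMap.id_coe,
        id_eq, ← mul_assoc, ← map_mul, inv_mul_cancel₀ hc, map_one, one_mul])

variable (K) in
/-- **A real basis of the mixed space consisting of the mixed embeddings of a `ℤ`-basis of the
ideal `c 𝓞_K`** (`c ≠ 0`): Mathlib's `latticeBasis` (embeddings of an integral basis) multiplied
by the embedding of `c` (MW's lattice `L_i ⊂ 𝔸_∞` with `L_i\𝔸_∞ ≃ k\𝔸/j_i(Γ_i)`).
[cite: MoeglinWaldspurger1995, proof of Lemma I.2.10] -/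
def periodBasis (c : 𝓞 K) (hc : c ≠ 0) :
    Module.Basis (Module.Free.ChooseBasisIndex ℤ (𝓞 K)) ℝ (mixedSpace K) :=
  (latticeBasis K).map (mulMixedEmbeddingEquiv K (c : K) (by exact_mod_cast hc))

/-- The period vectors are the mixed embeddings of `c` times the integral basis. [folklore] -/
theorem periodBasis_apply (c : 𝓞 K) (hc : c ≠ 0) (m : Module.Free.ChooseBasisIndex ℤ (𝓞 K)) :
    periodBasis K c hc m = mixedEmbedding K ((c * RingOfIntegers.basis K m : 𝓞 K) : K) := by
  rw [periodBasis, Module.Basis.map_apply, latticeBasis_apply, integralBasis_apply]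
  change mixedEmbedding K (c : K) * mixedEmbedding K (algebraMap (𝓞 K) K (RingOfIntegers.basis K m)) = _
  rw [← map_mul]
  rfl

variable (n k K) in
/-- **The period basis of the archimedean block coordinates**: the real basis of
`ArchBlockSpace n k K = (BlockPos → mixedSpace K)` made of the period vectors in each coordinate
(`Pi.basis`); a `ℤ`-basis of the period lattice `(c 𝓞_K)^{BlockPos}` of the functions
`e ↦ f((1 + e) y)` (MW's basis `(X_{iℓ})` with `j_i(exp X_{iℓ})` a basis of `L_i`).
[cite: MoeglinWaldspurger1995, proof of Lemma I.2.10] -/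
def blockPeriodBasis (c : 𝓞 K) (hc : c ≠ 0) :
    Module.Basis (Σ _ : BlockPos n k, Module.Free.ChooseBasisIndex ℤ (𝓞 K)) ℝ (ArchBlockSpace n k K) :=
  Pi.basis fun _ : BlockPos n k => periodBasis K c hc

/-- The block period vectors are the rational-integral block translations
`(c · Pi.single κ b_m)_∞`. [folklore] -/
theorem blockPeriodBasis_apply (c : 𝓞 K) (hc : c ≠ 0)
    (ι : Σ _ : BlockPos n k, Module.Free.ChooseBasisIndex ℤ (𝓞 K)) :
    blockPeriodBasis n k K c hc ι =
      fun κ => mixedEmbedding K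
        ((c * (Pi.single ι.1 (RingOfIntegers.basis K ι.2) : BlockPos n k → 𝓞 K) κ : 𝓞 K) : K) := by
  rw [blockPeriodBasis, Pi.basis_apply, periodBasis_apply]
  funext κ
  by_cases h : κ = ι.1
  · subst h
    rw [Pi.single_eq_same, Pi.single_eq_same]
  · rw [Pi.single_eq_of_ne h, Pi.single_eq_of_ne h, mul_zero]
    exact (map_zero _).symm

/-- **Periodicity of `e ↦ f((1 + e) y)` under the block period basis** (the hypothesis `hper` of
the torus lemma `norm_sub_le_sum_of_derivChains_of_basis`). [cite: MoeglinWaldspurger1995, proof of Lemma I.2.10] -/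
theorem apply_archUnipotent_add_blockPeriodBasis_mul {f : GL (Fin n) (AdeleRing (𝓞 K) K) → ℂ}
    (hleft : IsLeftInvariant (AdelicGroupData.gl n K) f)
    {U : Subgroup (GL (Fin n) (AdeleRing (𝓞 K) K))} (hfU : IsRightInvariantUnder U f) {c : 𝓞 K}
    (hc : c ≠ 0) {y : GL (Fin n) (AdeleRing (𝓞 K) K)}
    (hy : ∀ P : blockNilpotent n k (AdeleRing (𝓞 K) K), P ∈ finIntegralBlock c →
      y⁻¹ * unipotentOfBlock n k (AdeleRing (𝓞 K) K) (Multiplicative.ofAdd P) * y ∈ U)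
    (ι : Σ _ : BlockPos n k, Module.Free.ChooseBasisIndex ℤ (𝓞 K)) (e : ArchBlockSpace n k K) :
    f (archUnipotent n k K (e + blockPeriodBasis n k K c hc ι) * y) = f (archUnipotent n k K e * y) := by
  rw [blockPeriodBasis_apply]
  exact apply_archUnipotent_add_rat_mul hleft hfU hy _ e

end Period


/-! ### 3. The core estimate (MW's Lemma I.2.10 for `X = 1`) -/

section Core

variable {n : ℕ} {K : Type} [Field K] [NumberField K]

/-- Archimedean block unipotents are upper unitriangular (`i < k ≤ j` forces `i < j`; the proof of
`unipotentOfBlock_mem_upperUnitriangular` of `GLnCuspidalSiegelDifferences`, not imported here).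
[folklore] -/
theorem archUnipotent_mem_upperUnitriangular {k : ℕ} (e : ArchBlockSpace n k K) :
    archUnipotent n k K e ∈ upperUnitriangular (Fin n) (AdeleRing (𝓞 K) K) := by
  change unipotentOfBlock n k (AdeleRing (𝓞 K) K) (Multiplicative.ofAdd (archBlock n k K e)) ∈ _
  set Y : blockNilpotent n k (AdeleRing (𝓞 K) K) := archBlock n k K e with hY
  rw [mem_upperUnitriangular_iff, coe_unipotentOfBlock]
  refine ⟨fun i j hji => ?_, fun i => ?_⟩
  · have hji' : j < i := hji
    have hY0 : (Y : Matrix (Fin n) (Fin n) (AdeleRing (𝓞 K) K)) i j = 0 :=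
      apply_eq_zero_of_mem_blockNilpotent Y.2 fun h => by
        have h1 : (i : ℕ) < (j : ℕ) := lt_of_lt_of_le h.1 h.2
        exact absurd h1 (not_lt.2 (Fin.le_def.1 hji'.le))
    change (1 : Matrix (Fin n) (Fin n) (AdeleRing (𝓞 K) K)) i j +
      (Y : Matrix (Fin n) (Fin n) (AdeleRing (𝓞 K) K)) i j = 0
    rw [hY0, add_zero, Matrix.one_apply_ne (ne_of_gt hji')]
  · have hY0 : (Y : Matrix (Fin n) (Fin n) (AdeleRing (𝓞 K) K)) i i = 0 :=
      apply_eq_zero_of_mem_blockNilpotent Y.2 fun h => absurd (lt_of_lt_of_le h.1 h.2) (lt_irrefl _)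
    change (1 : Matrix (Fin n) (Fin n) (AdeleRing (𝓞 K) K)) i i +
      (Y : Matrix (Fin n) (Fin n) (AdeleRing (𝓞 K) K)) i i = 1
    rw [hY0, add_zero, Matrix.one_apply_eq]

/-- **Enlarging a Siegel datum by a compact set of archimedean unipotents**: if `(Ω, t₁)` is a
Siegel datum (`Ω ⊆ N(𝔸_K) M(𝔸_K)¹` relatively compact) and `P ⊆ 𝔫(K_∞)` is compact, then
`((1 + P) Ω, t₁)` is again a Siegel datum (`1 + P ⊆ N(𝔸_K)` is compact and `N` is a group). This is
the passage "`U₀(𝔸) S = U₀(k) S`" of Moeglin–Waldspurger's proof, in the form needed here.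
[cite: MoeglinWaldspurger1995, I.2.1 and proof of Lemma I.2.10] -/
theorem siegelDatum_archUnipotent_mul {k : ℕ} {Ω : Set (GL (Fin n) (AdeleRing (𝓞 K) K))}
    (hΩ : Ω ⊆ (upperUnitriangular (Fin n) (AdeleRing (𝓞 K) K) : Set (GL (Fin n) (AdeleRing (𝓞 K) K))) *
      (normOneDiagonal n K : Set (GL (Fin n) (AdeleRing (𝓞 K) K))))
    (hΩc : IsCompact (closure Ω)) {P : Set (ArchBlockSpace n k K)} (hP : IsCompact P) :
    (archUnipotent n k K '' P) * Ω ⊆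
        (upperUnitriangular (Fin n) (AdeleRing (𝓞 K) K) : Set (GL (Fin n) (AdeleRing (𝓞 K) K))) *
          (normOneDiagonal n K : Set (GL (Fin n) (AdeleRing (𝓞 K) K))) ∧
      IsCompact (closure ((archUnipotent n k K '' P) * Ω)) := by
  constructor
  · rintro _ ⟨u, ⟨e, -, rfl⟩, ω, hω, rfl⟩
    obtain ⟨x, hx, m, hm, hxm⟩ := Set.mem_mul.1 (hΩ hω)
    refine Set.mem_mul.2 ⟨archUnipotent n k K e * x,
      Subgroup.mul_mem _ (archUnipotent_mem_upperUnitriangular e) hx, m, hm, ?_⟩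
    rw [← hxm, mul_assoc]
  · haveI : T2Space (GL (Fin n) (AdeleRing (𝓞 K) K)) := t2Space_gl n K
    have hC : IsCompact ((archUnipotent n k K '' P) * closure Ω) :=
      (hP.image continuous_archUnipotent).mul hΩc
    exact hC.of_isClosed_subset isClosed_closure
      (closure_minimal (Set.mul_subset_mul_left subset_closure) hC.isClosed)

/-- The exponent vector of the conclusion: `∏ aᵢ^{(Λ - t α)ᵢ} = (∏ aᵢ^{Λᵢ}) · (a_{i₀}/a_{j₀})^{-t}`
for the root `α = e_{i₀} - e_{j₀}`. [folklore] -/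
theorem prod_rpow_sub_smul_root {x : Fin n → ℝ} (hx : ∀ i, 0 < x i) (Λ : Fin n → ℝ) (t : ℝ)
    (p q : Fin n) :
    ∏ i, x i ^ ((Λ - t • ((Pi.single p 1 : Fin n → ℝ) - Pi.single q 1) : Fin n → ℝ) i) =
      (∏ i, x i ^ (Λ i)) * (x p / x q) ^ (-t) := by
  rw [← prod_rpow_smul_single_sub_single hx (-t) p q, ← Finset.prod_mul_distrib]
  refine Finset.prod_congr rfl fun i _ => ?_
  rw [← Real.rpow_add (hx i)]
  congr 1
  simp only [Pi.sub_apply, Pi.smul_apply, smul_eq_mul]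
  ring

/-- **The core estimate: Moeglin–Waldspurger's Lemma I.2.10 for `GL_n`, cuspidal case, `X = 1`.**
Let `ψ : GL_n(𝔸_K) → ℂ` be left `GL_n(K)`-invariant, smooth in the archimedean variable and right
invariant under an admissible level `U`, with vanishing constant term along `P_{j₀}`
(`j₀ = i₀ + 1`), and suppose all its derivatives satisfy the Siegel growth bound with exponents
`(r, Λ)`. Then for every real `t` and every Siegel datum `(Ω, t₁)` there is `C` with
`‖ψ(z(ρ) ω diag(a) k)‖ ≤ C (ρ ⊔ ρ⁻¹)^r ∏ aᵢ^{(Λ - t α)ᵢ}` on the Siegel set (steps 1–6 of the module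
docstring). [cite: MoeglinWaldspurger1995, Lemma I.2.10] -/
theorem siegelGrowthBound_rootShift_core (hcpt : isCompact_glFiniteIntegralLevel n K)
    {ψ : (AdelicGroupData.gl n K).Adelic → ℂ}
    (hleft : IsLeftInvariant (AdelicGroupData.gl n K) ψ) (hs : IsArchSmooth (glArch n K) ψ)
    {U : Subgroup (GL (Fin n) (AdeleRing (𝓞 K) K))} (hU : U ∈ finiteLevelsGL n K)
    (hψU : IsRightInvariantUnder U ψ) {i₀ j₀ : Fin n} (hij : (j₀ : ℕ) = (i₀ : ℕ) + 1)
    (hcusp : CuspConditionGL n K ψ j₀) {r : ℝ} {Λ : Fin n → ℝ}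
    (hG : SiegelGrowthBoundGL hcpt ψ r Λ) (t : ℝ)
    (Ω : Set (GL (Fin n) (AdeleRing (𝓞 K) K))) (t₁ : ℝ) (ht₁ : 0 < t₁)
    (hΩ : Ω ⊆ (upperUnitriangular (Fin n) (AdeleRing (𝓞 K) K) : Set (GL (Fin n) (AdeleRing (𝓞 K) K))) *
      (normOneDiagonal n K : Set (GL (Fin n) (AdeleRing (𝓞 K) K))))
    (hΩc : IsCompact (closure Ω)) :
    ∃ C : ℝ, ∀ ρ : ℝ≥0ˣ, ∀ ω ∈ Ω, ∀ a : Fin n → ℝ≥0ˣ, (∏ i, ((a i : ℝ≥0) : ℝ)) = 1 →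
      (∀ i j : Fin n, (j : ℕ) = (i : ℕ) + 1 → t₁ * ((a j : ℝ≥0) : ℝ) ≤ ((a i : ℝ≥0) : ℝ)) →
        ∀ k ∈ standardMaximalCompactGL n K,
          ‖ψ (posRealScalar n K ρ * (ω * posRealDiagonal n K a * k))‖ ≤
            C * (((ρ : ℝ≥0) : ℝ) ⊔ (((ρ : ℝ≥0) : ℝ))⁻¹) ^ r *
              ∏ i, (((a i : ℝ≥0) : ℝ)) ^ ((Λ - t • ((Pi.single i₀ 1 : Fin n → ℝ) - Pi.single j₀ 1) : Fin n → ℝ) i) := by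
  classical
  -- Step 0: the number of derivatives `h = ⌈t⌉ ⊔ 1`
  set h : ℕ := max 1 ⌈t⌉₊ with hh_def
  have hh : 1 ≤ h := le_max_left _ _
  have hth : t ≤ (h : ℝ) :=
    (Nat.le_ceil t).trans (by rw [hh_def]; exact_mod_cast le_max_right 1 ⌈t⌉₊)
  -- Step 1: the uniform level over `closure Ω · K`
  set Θ : Set (GL (Fin n) (AdeleRing (𝓞 K) K)) :=
    closure Ω * (standardMaximalCompactGL n K : Set (GL (Fin n) (AdeleRing (𝓞 K) K))) with hΘ
  have hΘc : IsCompact Θ := hΩc.mul (isCompact_standardMaximalCompactGL n K)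
  obtain ⟨c, hc0, hlevel⟩ := exists_int_forall_conj_unipotentOfBlock_mem hU hΘc
  have hcK : (c : K) ≠ 0 := by exact_mod_cast hc0
  -- Step 2: the period basis and its (relatively compact) fundamental parallelepiped
  set 𝔅 := blockPeriodBasis n j₀ K c hc0 with h𝔅
  set Pc : Set (ArchBlockSpace n j₀ K) := closure (ZSpan.fundamentalDomain 𝔅) with hPc
  have hPcc : IsCompact Pc := isCompact_closure_fundamentalDomain 𝔅
  -- Step 3: the enlarged Siegel datum and the constants for the basis words of length `h`
  set Ω' : Set (GL (Fin n) (AdeleRing (𝓞 K) K)) := (archUnipotent n j₀ K '' Pc) * Ω with hΩ'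
  obtain ⟨hΩ'sub, hΩ'c⟩ := siegelDatum_archUnipotent_mul hΩ hΩc hPcc (k := (j₀ : ℕ))
  have hword : ∀ J : Fin h → GlInfIndex n K, ∃ CJ : ℝ, ∀ ρ : ℝ≥0ˣ, ∀ ω' ∈ Ω',
      ∀ a : Fin n → ℝ≥0ˣ, (∏ i, ((a i : ℝ≥0) : ℝ)) = 1 →
        (∀ i j : Fin n, (j : ℕ) = (i : ℕ) + 1 → t₁ * ((a j : ℝ≥0) : ℝ) ≤ ((a i : ℝ≥0) : ℝ)) →
          ∀ k ∈ standardMaximalCompactGL n K,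
            ‖basisWordDeriv J ψ (posRealScalar n K ρ * (ω' * posRealDiagonal n K a * k))‖ ≤
              CJ * (((ρ : ℝ≥0) : ℝ) ⊔ (((ρ : ℝ≥0) : ℝ))⁻¹) ^ r * ∏ i, (((a i : ℝ≥0) : ℝ)) ^ (Λ i) := by
    intro J
    obtain ⟨CJ, hCJ⟩ := hG Ω' t₁ ht₁ hΩ'sub hΩ'c
      (FreeAlgebra.basisFreeMonoid ℝ (archGroupGL n K).lie
        (FreeMonoid.ofList (List.ofFn fun q => lieOf (glInfBasis n K (J q)))))
    refine ⟨CJ, fun ρ ω' hω' a hprod hroot k hk => ?_⟩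
    have h1 := hCJ ρ ω' hω' a hprod hroot k hk
    have h2 : applyFree (AutomorphyDatum.gl n K hcpt).ofArch
        (FreeAlgebra.basisFreeMonoid ℝ (archGroupGL n K).lie
          (FreeMonoid.ofList (List.ofFn fun q => lieOf (glInfBasis n K (J q))))) ψ =
        basisWordDeriv J ψ :=
      (applyFree_basisFreeMonoid (glArch n K) _ ψ).trans (by rw [FreeMonoid.toList_ofList])
    rwa [h2] at h1
  choose CJ hCJ using hword
  set Cmax : ℝ := ∑ J, |CJ J| with hCmax
  have hCJle : ∀ J, |CJ J| ≤ Cmax := fun J =>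
    Finset.single_le_sum (f := fun J => |CJ J|) (fun J _ => abs_nonneg (CJ J)) (Finset.mem_univ J)
  have hCmax0 : 0 ≤ Cmax := Finset.sum_nonneg fun J _ => abs_nonneg _
  -- Step 4: Moeglin–Waldspurger's assertion (1)
  obtain ⟨Cb, hCb0, hCb⟩ := exists_forall_abs_coord_twistedBlockDir_le hij hΩ hΩc ht₁ (⇑𝔅)
  -- the constant
  set D : ℝ := (Module.finrank ℝ (Matrix (Fin n) (Fin n) (mixedSpace K)) : ℝ) with hD
  have hD0 : 0 ≤ D := Nat.cast_nonneg _
  set Nι : ℝ := (Fintype.card (Σ _ : BlockPos n j₀, Module.Free.ChooseBasisIndex ℤ (𝓞 K)) : ℝ) with hNι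
  have hNι0 : 0 ≤ Nι := Nat.cast_nonneg _
  refine ⟨Nι * (D ^ h * Cb ^ h * Cmax) * t₁ ^ (-((h : ℝ) - t)), fun ρ ω hω a hprod hroot k hk => ?_⟩
  -- notation and positivity
  set y : GL (Fin n) (AdeleRing (𝓞 K) K) := posRealScalar n K ρ * (ω * posRealDiagonal n K a * k) with hy
  set Pρ : ℝ := ((ρ : ℝ≥0) : ℝ) ⊔ (((ρ : ℝ≥0) : ℝ))⁻¹ with hPρ
  have hρ0 : 0 < ((ρ : ℝ≥0) : ℝ) := NNReal.coe_pos.2 (pos_iff_ne_zero.2 ρ.ne_zero)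
  have hP0 : 0 ≤ Pρ := hρ0.le.trans le_sup_left
  have ha0 : ∀ i, 0 < ((a i : ℝ≥0) : ℝ) := fun i =>
    NNReal.coe_pos.2 (pos_iff_ne_zero.2 (a i).ne_zero)
  set PΛ : ℝ := ∏ i, (((a i : ℝ≥0) : ℝ)) ^ (Λ i) with hPΛ
  have hPΛ0 : 0 ≤ PΛ := Finset.prod_nonneg fun i _ => Real.rpow_nonneg (ha0 i).le _
  set ra : ℝ := ((a j₀ : ℝ≥0) : ℝ) / ((a i₀ : ℝ≥0) : ℝ) with hra
  have hra0 : 0 ≤ ra := (div_pos (ha0 j₀) (ha0 i₀)).le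
  -- the level at the points `(1 + e) y`
  have hylevel : ∀ (e : ArchBlockSpace n j₀ K) (Q : blockNilpotent n j₀ (AdeleRing (𝓞 K) K)),
      Q ∈ finIntegralBlock c →
        (archUnipotent n j₀ K e * y)⁻¹ *
            unipotentOfBlock n j₀ (AdeleRing (𝓞 K) K) (Multiplicative.ofAdd Q) *
          (archUnipotent n j₀ K e * y) ∈ U := by
    intro e Q hQ
    refine hlevel j₀ Q hQ _ ⟨ω * k, Set.mul_mem_mul (subset_closure hω) hk, ?_⟩
    rw [map_mul, GLn.sndHom_archUnipotent, one_mul, hy, GLn.sndHom_siegelPoint]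
  have hylevel0 : ∀ Q : blockNilpotent n j₀ (AdeleRing (𝓞 K) K), Q ∈ finIntegralBlock c →
      y⁻¹ * unipotentOfBlock n j₀ (AdeleRing (𝓞 K) K) (Multiplicative.ofAdd Q) * y ∈ U := by
    intro Q hQ
    have h1 := hylevel 0 Q hQ
    rwa [archUnipotent_zero, one_mul] at h1
  -- Step 5: the basis words at the translated points `(1 + e) y`, for all `e`
  have hbasis : ∀ (J : Fin h → GlInfIndex n K) (e : ArchBlockSpace n j₀ K),
      ‖basisWordDeriv J ψ (archUnipotent n j₀ K e * y)‖ ≤ Cmax * Pρ ^ r * PΛ := by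
    intro J e
    -- periodicity: reduce `e` to the fundamental parallelepiped
    have hperJ : ∀ ι e', basisWordDeriv J ψ (archUnipotent n j₀ K (e' + 𝔅 ι) * y) =
        basisWordDeriv J ψ (archUnipotent n j₀ K e' * y) := fun ι e' =>
      apply_archUnipotent_add_blockPeriodBasis_mul
        (IsLeftInvariantUnder.iterLieDeriv_gl (V := (AdelicGroupData.gl n K).arithmeticSubgroup) hleft _)
        (hψU.iterLieDeriv_gl hU _) hc0 hylevel0 ι e'
    rw [apply_eq_apply_fract 𝔅 (G := fun e' => basisWordDeriv J ψ (archUnipotent n j₀ K e' * y))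
      hperJ e]
    set e₀ : ArchBlockSpace n j₀ K := ZSpan.fract 𝔅 e with he₀
    have he₀P : e₀ ∈ Pc := subset_closure (ZSpan.fract_mem_fundamentalDomain 𝔅 e)
    have hω' : archUnipotent n j₀ K e₀ * ω ∈ Ω' := Set.mul_mem_mul (Set.mem_image_of_mem _ he₀P) hω
    have hz := Subgroup.mem_center_iff.1 (posRealScalar_mem_center n K ρ) (archUnipotent n j₀ K e₀)
    have hpt : archUnipotent n j₀ K e₀ * y =
        posRealScalar n K ρ * (archUnipotent n j₀ K e₀ * ω * posRealDiagonal n K a * k) := by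
      rw [hy, ← mul_assoc, hz]
      simp only [mul_assoc]
    change ‖basisWordDeriv J ψ (archUnipotent n j₀ K e₀ * y)‖ ≤ _
    rw [hpt]
    refine (hCJ J ρ _ hω' a hprod hroot k hk).trans ?_
    exact mul_le_mul_of_nonneg_right (mul_le_mul_of_nonneg_right
      ((le_abs_self _).trans (hCJle J)) (Real.rpow_nonneg hP0 _)) hPΛ0
  -- Step 6: the top of the derivative chains, for all `e`
  have hcoordy : ∀ (ι : Σ _ : BlockPos n j₀, Module.Free.ChooseBasisIndex ℤ (𝓞 K))
      (e' : GlInfIndex n K),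
      |(glInfBasis n K).coord e' (twistedBlockDir n j₀ K y (𝔅 ι))| ≤ ra * Cb := fun ι e' =>
    hCb ρ ω hω a hroot k hk ι e'
  set Mb : ℝ := D ^ h * (ra * Cb) ^ h * (Cmax * Pρ ^ r * PΛ) with hMb
  have htop : ∀ (ι : Σ _ : BlockPos n j₀, Module.Free.ChooseBasisIndex ℤ (𝓞 K))
      (e : ArchBlockSpace n j₀ K),
      ‖blockDerivChain n j₀ K ψ y (𝔅 ι) h (archUnipotent n j₀ K e * y)‖ ≤ Mb := by
    intro ι e
    rw [blockDerivChain_eq_iterLieDeriv_ofFn]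
    exact hs.norm_iterLieDeriv_ofFn_apply_le (fun _ : Fin h => lieOf (twistedBlockDir n j₀ K y (𝔅 ι)))
      (mul_nonneg hra0 hCb0) (fun _ e' => hcoordy ι e') _ (fun J => hbasis J e)
  -- Step 7: oscillation through the torus lemma, and the cusp condition
  -- the point read in the type of the datum (for the cusp condition)
  obtain ⟨yA, hyA⟩ : ∃ yA : (AdelicGroupData.gl n K).Adelic, yA = y := ⟨y, rfl⟩
  have hosc : ∀ X ∈ scaledBlockFundamentalDomain n j₀ K (c : K),
      ‖ψ (glUnipotent n j₀ K (Multiplicative.ofAdd X) * yA) - ψ yA‖ ≤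
        ∑ _ι : (Σ _ : BlockPos n j₀, Module.Free.ChooseBasisIndex ℤ (𝓞 K)), Mb := by
    intro X hX
    -- finite steps drop out
    have hfin : blockFinPart X ∈ finIntegralBlock c := blockFinPart_mem_finIntegralBlock hX
    have hconv : glUnipotent n j₀ K (Multiplicative.ofAdd X) * yA =
        archUnipotent n j₀ K (archCoords n j₀ K X) *
          unipotentOfBlock n j₀ (AdeleRing (𝓞 K) K) (Multiplicative.ofAdd (blockFinPart X)) * y := by
      rw [hyA]
      conv_lhs => rw [← blockArchPart_add_blockFinPart X]
      rw [ofAdd_add, map_mul, archUnipotent_def, archBlock_archCoords]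
      rfl
    have h0 : ψ yA = ψ (archUnipotent n j₀ K 0 * y) := by rw [hyA, archUnipotent_zero, one_mul]
    rw [hconv, apply_unipotentOfBlock_mul_eq_of_conj_mem hψU (hylevel0 _ hfin)
      (archUnipotent n j₀ K (archCoords n j₀ K X)), h0]
    exact norm_sub_le_sum_of_derivChains_of_basis 𝔅 hh
      (F := fun e => ψ (archUnipotent n j₀ K e * y))
      (D := fun ι j e => blockDerivChain n j₀ K ψ y (𝔅 ι) j (archUnipotent n j₀ K e * y))
      (fun ι => rfl) (fun ι e => apply_archUnipotent_add_blockPeriodBasis_mul hleft hψU hc0 hylevel0 ι e)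
      (fun ι j _ e s' => hs.hasDerivAt_blockDerivChain y e (𝔅 ι) j s') (M := fun _ => Mb) htop _ _
  have hmain : ‖ψ yA‖ ≤ ∑ _ι : (Σ _ : BlockPos n j₀, Module.Free.ChooseBasisIndex ℤ (𝓞 K)), Mb :=
    norm_le_of_cuspConditionGL hcusp hcK yA hosc
  rw [hyA] at hmain
  -- Step 8: the root gap `a_{i₀}/a_{j₀} ≥ t₁` and the arithmetic of the constants
  set q : ℝ := ((a i₀ : ℝ≥0) : ℝ) / ((a j₀ : ℝ≥0) : ℝ) with hq
  have hq0 : 0 < q := div_pos (ha0 i₀) (ha0 j₀)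
  have hqt : t₁ ≤ q := by
    rw [hq, le_div_iff₀ (ha0 j₀)]
    exact hroot i₀ j₀ hij
  have hraq : ra = q⁻¹ := by rw [hra, hq, inv_div]
  have hrah : ra ^ h ≤ t₁ ^ (-((h : ℝ) - t)) * q ^ (-t) := by
    rw [hraq, ← Real.rpow_natCast, Real.inv_rpow hq0.le, ← Real.rpow_neg hq0.le,
      show (-(h : ℝ)) = -t + -((h : ℝ) - t) by ring, Real.rpow_add hq0, mul_comm]
    exact mul_le_mul_of_nonneg_right
      (Real.rpow_le_rpow_of_nonpos ht₁ hqt (by linarith)) (Real.rpow_nonneg hq0.le _)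
  have hexp : ∏ i, (((a i : ℝ≥0) : ℝ)) ^
      ((Λ - t • ((Pi.single i₀ 1 : Fin n → ℝ) - Pi.single j₀ 1) : Fin n → ℝ) i) =
        PΛ * q ^ (-t) := prod_rpow_sub_smul_root ha0 Λ t i₀ j₀
  rw [hexp]
  have hsum : ∑ _ι : (Σ _ : BlockPos n j₀, Module.Free.ChooseBasisIndex ℤ (𝓞 K)), Mb = Nι * Mb := by
    rw [Finset.sum_const, Finset.card_univ, nsmul_eq_mul]
  have hconst0 : 0 ≤ Nι * (D ^ h * Cb ^ h * Cmax) * Pρ ^ r * PΛ := by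
    have : 0 ≤ Pρ ^ r := Real.rpow_nonneg hP0 _
    positivity
  calc ‖ψ y‖ ≤ Nι * Mb := hmain.trans hsum.le
    _ = Nι * (D ^ h * Cb ^ h * Cmax) * Pρ ^ r * PΛ * ra ^ h := by rw [hMb, mul_pow]; ring
    _ ≤ Nι * (D ^ h * Cb ^ h * Cmax) * Pρ ^ r * PΛ * (t₁ ^ (-((h : ℝ) - t)) * q ^ (-t)) :=
        mul_le_mul_of_nonneg_left hrah hconst0
    _ = Nι * (D ^ h * Cb ^ h * Cmax) * t₁ ^ (-((h : ℝ) - t)) * Pρ ^ r * (PΛ * q ^ (-t)) := by ring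

end Core

/-! ### 4. The discharge -/

section Discharge

variable {n : ℕ} {K : Type} [Field K] [NumberField K]
  (hcpt : isCompact_glFiniteIntegralLevel n K)

/-- **Moeglin–Waldspurger's Lemma I.2.10 for `GL_n` over a number field, cuspidal case** — the
named fact `AutomorphicRepsGL.siegelGrowthBound_rootShift_of_cuspCondition hcpt` holds: for
`φ : GL_n(𝔸_K) → ℂ` left `GL_n(K)`-invariant, smooth in the archimedean variable and of some
admissible level, with vanishing constant term along the maximal parabolic `P_j` (`j = i + 1`), the
Siegel growth bound with exponents `(r, Λ)` implies the one with exponents `(r, Λ - t (eᵢ - eⱼ))`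
for every `t > 0`. Proof: a derivative `p φ` is a finite real combination of iterated derivatives
`X₁ ⋯ X_m φ` along words, each of which is again left invariant, smooth, of the same level and
cuspidal along `P_j` (`CuspConditionGL.iterLieDeriv`) and satisfies the Siegel growth bound with
exponents `(r, Λ)` (`(q w) φ = q (w φ)`, `applyFree_mul_of_isArchSmooth`); the core estimate
`siegelGrowthBound_rootShift_core` (MW's argument for `X = 1`) bounds each of them, and the bounds
add up. [cite: MoeglinWaldspurger1995, Lemma I.2.10] -/
theorem AutomorphicRepsGL.siegelGrowthBound_rootShift_of_cuspCondition_holds :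
    AutomorphicRepsGL.siegelGrowthBound_rootShift_of_cuspCondition hcpt := by
  intro φ hleft hsm hlev i j hij hcusp r _hr Λ hΛ t _ht Ω t₁ ht₁ hΩ hΩc p
  obtain ⟨U, hU, hφU⟩ := hlev
  have hs : IsArchSmooth (glArch n K) φ := hsm
  -- each word is handled by the core estimate
  have hword : ∀ w : FreeMonoid (AutomorphyDatum.gl n K hcpt).arch.lie, ∃ Cw : ℝ, ∀ ρ : ℝ≥0ˣ, ∀ ω ∈ Ω,
      ∀ a : Fin n → ℝ≥0ˣ, (∏ i, ((a i : ℝ≥0) : ℝ)) = 1 →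
        (∀ i j : Fin n, (j : ℕ) = (i : ℕ) + 1 → t₁ * ((a j : ℝ≥0) : ℝ) ≤ ((a i : ℝ≥0) : ℝ)) →
          ∀ k ∈ standardMaximalCompactGL n K,
            ‖iterLieDeriv (AutomorphyDatum.gl n K hcpt).ofArch (FreeMonoid.toList w) φ
                (posRealScalar n K ρ * (ω * posRealDiagonal n K a * k))‖ ≤
              Cw * (((ρ : ℝ≥0) : ℝ) ⊔ (((ρ : ℝ≥0) : ℝ))⁻¹) ^ r *
                ∏ i', (((a i' : ℝ≥0) : ℝ)) ^
                  ((Λ - t • ((Pi.single i 1 : Fin n → ℝ) - Pi.single j 1) : Fin n → ℝ) i') := by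
    intro w
    set ψ : (AdelicGroupData.gl n K).Adelic → ℂ := iterLieDeriv (glArch n K) (FreeMonoid.toList w) φ
      with hψ
    have hψleft : IsLeftInvariant (AdelicGroupData.gl n K) ψ :=
      IsLeftInvariantUnder.iterLieDeriv_gl (V := (AdelicGroupData.gl n K).arithmeticSubgroup) hleft _
    have hψs : IsArchSmooth (glArch n K) ψ := hs.iterLieDeriv_gl _
    have hψU : IsRightInvariantUnder U ψ := hφU.iterLieDeriv_gl hU _
    have hψcusp : CuspConditionGL n K ψ j := hcusp.iterLieDeriv hleft hs hU hφU _
    have hψG : SiegelGrowthBoundGL hcpt ψ r Λ := by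
      intro Ω₂ t₂ ht₂ hΩ₂ hΩ₂c p₂
      obtain ⟨C₂, hC₂⟩ := hΛ Ω₂ t₂ ht₂ hΩ₂ hΩ₂c
        (p₂ * FreeAlgebra.basisFreeMonoid ℝ (AutomorphyDatum.gl n K hcpt).arch.lie w)
      refine ⟨C₂, fun ρ ω hω a hprod hroot k hk => ?_⟩
      have h1 := hC₂ ρ ω hω a hprod hroot k hk
      have h2 : applyFree (AutomorphyDatum.gl n K hcpt).ofArch
          (p₂ * FreeAlgebra.basisFreeMonoid ℝ (AutomorphyDatum.gl n K hcpt).arch.lie w) φ =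
            applyFree (AutomorphyDatum.gl n K hcpt).ofArch p₂ ψ := by
        have e1 := applyFree_mul_of_isArchSmooth hs p₂
          (FreeAlgebra.basisFreeMonoid ℝ (archGroupGL n K).lie w)
        have e2 := applyFree_basisFreeMonoid (glArch n K) w φ
        rw [e2] at e1
        exact e1
      rwa [h2] at h1
    exact siegelGrowthBound_rootShift_core hcpt hψleft hψs hU hψU hij hψcusp hψG t Ω t₁ ht₁ hΩ hΩc
  choose Cw hCw using hword
  -- sum over the words of `p`
  set S := ((FreeAlgebra.basisFreeMonoid ℝ (AutomorphyDatum.gl n K hcpt).arch.lie).repr p).support with hS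
  refine ⟨∑ w ∈ S, |((FreeAlgebra.basisFreeMonoid ℝ (AutomorphyDatum.gl n K hcpt).arch.lie).repr p w : ℝ)| * |Cw w|,
    fun ρ ω hω a hprod hroot k hk => ?_⟩
  set g : GL (Fin n) (AdeleRing (𝓞 K) K) := posRealScalar n K ρ * (ω * posRealDiagonal n K a * k) with hg
  set Pρ : ℝ := ((ρ : ℝ≥0) : ℝ) ⊔ (((ρ : ℝ≥0) : ℝ))⁻¹ with hPρ
  set Pμ : ℝ := ∏ i', (((a i' : ℝ≥0) : ℝ)) ^
    ((Λ - t • ((Pi.single i 1 : Fin n → ℝ) - Pi.single j 1) : Fin n → ℝ) i') with hPμ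
  have hρ0 : 0 < ((ρ : ℝ≥0) : ℝ) := NNReal.coe_pos.2 (pos_iff_ne_zero.2 ρ.ne_zero)
  have hP0 : 0 ≤ Pρ := hρ0.le.trans le_sup_left
  have hPr0 : 0 ≤ Pρ ^ r := Real.rpow_nonneg hP0 _
  have hPΛ0 : 0 ≤ Pμ := Finset.prod_nonneg fun i' _ => Real.rpow_nonneg (NNReal.coe_nonneg _) _
  rw [applyFree_eq_finset_sum, Finset.sum_apply]
  refine (norm_sum_le _ _).trans ?_
  rw [Finset.sum_mul, Finset.sum_mul]
  refine Finset.sum_le_sum fun w hw => ?_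
  rw [Pi.smul_apply, _root_.norm_smul, Complex.norm_real, Real.norm_eq_abs]
  have h1 := hCw w ρ ω hω a hprod hroot k hk
  calc |((FreeAlgebra.basisFreeMonoid ℝ (AutomorphyDatum.gl n K hcpt).arch.lie).repr p w : ℝ)| *
        ‖iterLieDeriv (AutomorphyDatum.gl n K hcpt).ofArch (FreeMonoid.toList w) φ g‖
      ≤ |((FreeAlgebra.basisFreeMonoid ℝ (AutomorphyDatum.gl n K hcpt).arch.lie).repr p w : ℝ)| *
          (Cw w * Pρ ^ r * Pμ) :=
        mul_le_mul_of_nonneg_left h1 (abs_nonneg _)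
    _ ≤ |((FreeAlgebra.basisFreeMonoid ℝ (AutomorphyDatum.gl n K hcpt).arch.lie).repr p w : ℝ)| *
          (|Cw w| * Pρ ^ r * Pμ) :=
        mul_le_mul_of_nonneg_left (mul_le_mul_of_nonneg_right
          (mul_le_mul_of_nonneg_right (le_abs_self _) hPr0) hPΛ0) (abs_nonneg _)
    _ = |((FreeAlgebra.basisFreeMonoid ℝ (AutomorphyDatum.gl n K hcpt).arch.lie).repr p w : ℝ)| *
          |Cw w| * Pρ ^ r * Pμ := by
        ring

end Discharge

end Literature.NumberTheory.Automorphic
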